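/-
COR-CM (cell pub-hodgecm2, stage 2 of the Hodge ladder) — count-neutral KERNEL COMBINATORICS «the octic product column G = Q₈ × B, D₄ × B: the number of blocks in closed form»
(seat prover-pub-hodgecm2-b23-g45-0, binder prover b23, gen 45; own census lane OCTIC-PRODUCT, claim HOME/INBOX.md l.18829).  Theorems only — gen 44ʼs `Census/QuarticInversionBlockCount.lean` along an octic product datum (ζ = 1: the same closed form, the outer cosets contributing nothing when `B` has no element of order 4; ζ = 0, `|B|` odd: the cosets `y ι(H₀)`, `t y ι(H₀)` consist of elements of order `2·ord s` missing `c`), on b09ʼs Burnside count BY NAME; no `decide` beyond closed identities in `ZMod 2`/small numerals, no certificate, no named fact, no `sorry`.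
`Interfaces.lean` (C1), every E term, B01, `Transposition/*`, `PortJoin/*`, `D2Bridge/*` untouched.
HONEST FRAMING: `HC_CM` is NOT proved, here or anywhere in the tree; nothing here is a period, a count of record or a headline.
T5: n/a-class (hypothesis binders = the datum equations / the slot data only); checker: self, 2026-08-24.
-/
import Summits.HodgeConjecture.CorCM.Census.OcticProductStabiliser
import Summits.HodgeConjecture.CorCM.Census.BlockParityBurnside
import Summits.HodgeConjecture.CorCM.Census.QuarticInversionBlockCount

/-!
# The octic product column: the number of blocks in closed form (`Q₈ × B`: `B` without elements of order `4`; `D₄ × B`: `|B|` odd)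

COR-CM (cell `pub-hodgecm2`, stage 2 of the Hodge ladder), count-neutral KERNEL COMBINATORICS by the binder seat b23 (gen 45; lane OCTIC-PRODUCT, HOME/INBOX.md l.18829 — the port of gen 44ʼs quartic inversion lane `Census/QuarticInversion*` to the datum with `y` CENTRAL on `ι(H₀)`).  Theorems only, on top of `Census/QuarticInversion{Dictionary,Cosets,Stabiliser}.lean` and seat b09's
Burnside count `Census/BlockParityBurnside.lean` (`card_block_mul_card`: `β · |G| = Σ_g [c ∉ ⟨g⟩] 2^{|G|/ord g/2}`) used BY NAME; no `decide` beyond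
closed identities in `ZMod 2`/small numerals, no certificate, no named fact, no `sorry`.  `Interfaces.lean` (C1), every E term, B01, `Transposition/*`,
`PortJoin/*` untouched.  HONEST FRAMING: `HC_CM` is NOT proved, here or anywhere in the tree; nothing here is a period, a count of record or a headline.

THE COUNT.  Along an octic product datum `D : Datum G c B ζ` (`Census/OcticProductDictionary.lean`), the four cosets contribute to b09's Burnside
sum as follows: `ι(e, s)` contributes unless `e = 1` and `ord s` is odd (`c ∈ ⟨ι(e,s)⟩ ↔ e = 1 ∧ ord s odd`), i.e. `(1 + [ord s even]) · 16^{|B|/ord s}`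
per `s`; the three outer cosets square to `ι(e)·ι(2a)` (`e = c` for `t ι a`, `e = ι(ζ,0)` for `y ι a`, `t y ι a`): for `ζ = 1` and `B` without elements of
order `4` every outer element has `c` among its powers and contributes nothing; for `ζ = 0` the coset `t ι(H₀)` contributes nothing while `y ι a` and
`t y ι a` have order `2·ord(2a)` and miss `c` (`orderOf_eq_two_mul_of_sq`), contributing `4^{|B|/ord s}` each when `|B|` is odd.  Hence
* **ζ = 1 (`Q₈ × B`, no element of order `4` in `B`): `β · 8|B| = Σ_{s ∈ B} (1 + [ord s even]) · 16^{|B| / ord s}`** (`card_block_mul_of_one`) — the same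
  closed form as gen 44ʼs `y`-inverting datum (`Census/QuarticInversionBlockCount.lean`, whose rows `β(Q₈) = 2`, `β(Q₈ × ℤ/2) = 18` are rows of this
  column too: for `|B| ≤ 2` the two data coincide); row **`β(Q₈ × ℤ/3) = 172`** (`card_block_eq_oneHundredSeventyTwo`; lit-andre-3ʼs `Census/TwentyFourC3Q8*`);
* **ζ = 0 (`D₄ × B`, `|B|` odd): `β · 8|B| = Σ_{s ∈ B} 16^{|B| / ord s} + 4 · Σ_{s ∈ B} 4^{|B| / ord s}`** (`card_block_mul_of_zero`); row
  **`β(D₄ × ℤ/3) = 184`** (`card_block_eq_oneHundredEightyFour`; `β(D₄, r²) = 4` is gen 44ʼs `QuarticInversion.card_block_eq_four`).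
With `β = φ₂` resp. `β = φ₂ + 2` (`Census/OcticProductStabiliser.lean`) these put the law `μ = φ₂` of the column in closed form.  All [folklore].

## References
* [Milne1999] J. S. Milne, Lefschetz motives and the Tate conjecture, Compositio Math. 117 (1999), Prop. 2.1, p. 54.
-/

namespace Summit.HodgeConjecture.CorCM.Census.OcticProduct

open Finset
open Summit.HodgeConjecture.CorCM.Prior.AllgGroup.RfwfAllgGroup
open Summit.HodgeConjecture.CorCM.Census.BlockParity
open Summit.HodgeConjecture.CorCM.Census.TypeStabiliser


open Summit.HodgeConjecture.CorCM.Census.QuarticInversion (addOrderOf_one_mk_of_even addOrderOf_zero_mk)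

noncomputable section

section Generic

variable {G : Type*} [Group G] {c : G} {A : Type} [AddCommGroup A] {ζ : ZMod 2} (D : Datum G c A ζ)

/-! ## §1 Orders and `c`-membership in the coset `ι(ℤ/2 × B)` -/

/-- `ιHom` is injective. [folklore] -/
private theorem ιHom_injective : Function.Injective (ιHom D) := fun _ _ h => Multiplicative.toAdd.injective (D.inj h)

/-- **`ι` preserves orders**: `ord ι(e, s) = ord (e, s)`. [folklore] -/
private theorem orderOf_ι_mk (e : ZMod 2) (s : A) : orderOf (D.ι (e, s)) = addOrderOf ((e, s) : ZMod 2 × A) := by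
  rw [← ιHom_apply, orderOf_injective (ιHom D) (ιHom_injective D), orderOf_ofAdd_eq_addOrderOf]

/-- **`c ∈ ⟨ι a⟩ ↔ a.1 = 1 ∧ ord a.2` odd.** [folklore] -/
private theorem c_mem_zpowers_ι_iff_odd' (a : ZMod 2 × A) : c ∈ Subgroup.zpowers (D.ι a) ↔ a.1 = 1 ∧ Odd (addOrderOf a.2) := by
  obtain ⟨e, s⟩ := a
  show c ∈ Subgroup.zpowers (D.ι (e, s)) ↔ e = 1 ∧ Odd (addOrderOf s)
  constructor
  · intro h
    obtain ⟨k, hk⟩ := Subgroup.mem_zpowers_iff.mp h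
    rw [← ι_zpow] at hk
    have hks : k • ((e, s) : ZMod 2 × A) = ((1 : ZMod 2), (0 : A)) := D.inj (hk.trans D.map_c.symm)
    have h1 : k • e = 1 := by simpa using congrArg Prod.fst hks
    have h2 : k • s = 0 := by simpa using congrArg Prod.snd hks
    have hkodd : Odd k := by
      rcases Int.even_or_odd k with ⟨j, rfl⟩ | hodd
      · exfalso
        have key2 : ∀ u : ZMod 2, u + u = 0 := by decide
        rw [add_zsmul, key2] at h1
        exact zero_ne_one h1
      · exact hodd
    have key : ∀ u : ZMod 2, u ≠ 0 → u = 1 := by decide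
    refine ⟨key e fun he => ?_, ?_⟩
    · rw [he, smul_zero] at h1
      exact zero_ne_one h1
    · have hdvd : (addOrderOf s : ℤ) ∣ k := addOrderOf_dvd_iff_zsmul_eq_zero.mpr h2
      obtain ⟨j, hj⟩ := hkodd
      rw [Int.natCast_dvd] at hdvd
      have hodd' : Odd k.natAbs := by
        rw [Int.natAbs_odd]
        exact ⟨j, hj⟩
      exact hodd'.of_dvd_nat hdvd
  · rintro ⟨rfl, hodd⟩
    refine Subgroup.mem_zpowers_iff.mpr ⟨(addOrderOf s : ℤ), ?_⟩
    have hn : addOrderOf s • ((1 : ZMod 2), s) = (1, 0) := by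
      rw [Prod.smul_mk, addOrderOf_nsmul_eq_zero, nsmul_eq_mul, mul_one, ← ZMod.natCast_mod, Nat.odd_iff.mp hodd, Nat.cast_one]
    rw [zpow_natCast, ← ι_pow, hn]
    exact D.map_c

end Generic

/-! ## §2 The Burnside sum along the four cosets -/

section Count

variable {G : Type*} [Group G] [Fintype G] [DecidableEq G] {c : G}
variable {A : Type} [AddCommGroup A] [Fintype A] [DecidableEq A] {ζ : ZMod 2} (D : Datum G c A ζ)

omit [DecidableEq G] [DecidableEq A] in
include D in
/-- The contribution of the coset `ι(ℤ/2 × B)` to the Burnside sum: `Σ_{s} (1 + [ord s even]) · 16^{|B|/ord s}`. [folklore] -/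
private theorem sum_ι_coset :
    ∑ a : ZMod 2 × A, (if c ∈ Subgroup.zpowers (D.ι a) then 0 else 2 ^ (Fintype.card G / orderOf (D.ι a) / 2)) =
      ∑ s : A, (if Even (addOrderOf s) then 2 else 1) * 16 ^ (Fintype.card A / addOrderOf s) := by
  classical
  rw [Fintype.sum_prod_type_right]
  refine Finset.sum_congr rfl fun s _ => ?_
  have huniv : (Finset.univ : Finset (ZMod 2)) = {0, 1} := by decide
  have h0 : ¬ (c ∈ Subgroup.zpowers (D.ι (0, s))) := fun h => zero_ne_one ((c_mem_zpowers_ι_iff_odd' D (0, s)).mp h).1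
  rw [huniv, Finset.sum_pair (show (0 : ZMod 2) ≠ 1 by decide), if_neg h0, orderOf_ι_mk, addOrderOf_zero_mk, ← card_group_eq_eight_mul D]
  obtain ⟨d, hd⟩ := addOrderOf_dvd_card (x := s)
  have hpos : 0 < addOrderOf s := addOrderOf_pos s
  have hdiv : Fintype.card A / addOrderOf s = d := by rw [hd, Nat.mul_div_cancel_left d hpos]
  have hdiv' : 8 * Fintype.card A / addOrderOf s / 2 = 4 * d := by
    rw [hd, show 8 * (addOrderOf s * d) = addOrderOf s * (8 * d) by ring, Nat.mul_div_cancel_left _ hpos]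
    omega
  rw [hdiv, hdiv', pow_mul, show (2 : ℕ) ^ 4 = 16 by norm_num]
  by_cases hev : Even (addOrderOf s)
  · have h1 : ¬ (c ∈ Subgroup.zpowers (D.ι (1, s))) := fun h =>
      (Nat.not_odd_iff_even.mpr hev) ((c_mem_zpowers_ι_iff_odd' D (1, s)).mp h).2
    rw [if_neg h1, if_pos hev, orderOf_ι_mk, addOrderOf_one_mk_of_even hev, hdiv', pow_mul, show (2 : ℕ) ^ 4 = 16 by norm_num]
    ring
  · have h1 : c ∈ Subgroup.zpowers (D.ι (1, s)) := (c_mem_zpowers_ι_iff_odd' D (1, s)).mpr ⟨rfl, Nat.not_even_iff_odd.mp hev⟩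
    rw [if_pos h1, if_neg hev]
    ring

omit [Fintype G] [DecidableEq G] [Fintype A] [DecidableEq A] in
/-- The coset `t ι(ℤ/2 × B)` contributes nothing when `B` has no element of order `4`. [folklore] -/
private theorem sum_tι_coset_eq_zero (hB : ∀ s : A, ¬ 4 ∣ addOrderOf s) (f : G → ℕ) :
    (fun a : ZMod 2 × A => if c ∈ Subgroup.zpowers (D.t * D.ι a) then 0 else f (D.t * D.ι a)) = fun _ => 0 := by
  funext a
  rw [if_pos (c_mem_zpowers_tι D hB a)]

omit [DecidableEq A] in
include D in
/-- **b09's Burnside sum reindexed along the four cosets.** [folklore] -/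
private theorem card_block_mul_card_eq_sum_cosets (hc2 : c * c = 1) :
    Fintype.card (BlockParity.Block c) * Fintype.card G =
      ∑ p : Fin 4 × (ZMod 2 × A), (if c ∈ Subgroup.zpowers (cosetElt D p.1 p.2) then 0 else
        2 ^ (Fintype.card G / orderOf (cosetElt D p.1 p.2) / 2)) := by
  classical
  rw [card_block_mul_card c hc2 (mul_c_comm D), ← Equiv.sum_comp (cosetEquiv D)]
  rfl

end Count

/-! ## §3 The two closed forms -/

section One

variable {G : Type*} [Group G] [Fintype G] [DecidableEq G] {c : G}
variable {A : Type} [AddCommGroup A] [Fintype A] [DecidableEq A] (D : Datum G c A 1)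

omit [DecidableEq A] in
include D in
/-- **ζ = 1 (`Q₈ × B`), `B` without elements of order `4`: `β(G, c) · 8|B| = Σ_{s ∈ B} (1 + [ord s even]) · 16^{|B| / ord s}`.** [folklore] -/
theorem card_block_mul_of_one (hc2 : c * c = 1) (hB : ∀ s : A, ¬ 4 ∣ addOrderOf s) :
    ∑ s : A, (if Even (addOrderOf s) then 2 else 1) * 16 ^ (Fintype.card A / addOrderOf s) =
      Fintype.card (BlockParity.Block c) * (8 * Fintype.card A) := by
  classical
  symm
  rw [card_group_eq_eight_mul D, card_block_mul_card_eq_sum_cosets D hc2, Fintype.sum_prod_type, Fin.sum_univ_four]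
  simp only [cosetElt, Matrix.cons_val_zero, Matrix.cons_val_one, Matrix.cons_val]
  rw [sum_ι_coset D]
  have hy : ∀ a : ZMod 2 × A, c ∈ Subgroup.zpowers (D.y * D.ι a) := c_mem_zpowers_yι_of_one D hB
  have hty : ∀ a : ZMod 2 × A, c ∈ Subgroup.zpowers (D.t * (D.y * D.ι a)) := c_mem_zpowers_tyι_of_one D hB
  have ht : ∀ a : ZMod 2 × A, c ∈ Subgroup.zpowers (D.t * D.ι a) := c_mem_zpowers_tι D hB
  simp only [hy, hty, ht, if_true, Finset.sum_const_zero, add_zero]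

include D in
/-- `β = 172` for `|B| = 3`, `ζ = 1`: `β · 24 = 16³ + 2 · 16`. [folklore] -/
private theorem card_block_eq_oneHundredSeventyTwo_of_card (hc2 : c * c = 1) (h3 : Fintype.card A = 3) :
    Fintype.card (BlockParity.Block c) = 172 := by
  classical
  have hord : ∀ s : A, s ≠ 0 → addOrderOf s = 3 := fun s hs => by
    have hd := addOrderOf_dvd_card (x := s); rw [h3] at hd
    rcases (Nat.dvd_prime Nat.prime_three).mp hd with h | h
    · exact absurd (AddMonoid.addOrderOf_eq_one_iff.mp h) hs
    · exact h
  have hB : ∀ s : A, ¬ 4 ∣ addOrderOf s := fun s h => by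
    by_cases hs : s = 0
    · rw [hs, addOrderOf_zero] at h; omega
    · rw [hord s hs] at h; omega
  have h := (card_block_mul_of_one D hc2 hB).symm
  rw [← Finset.add_sum_erase _ _ (Finset.mem_univ (0 : A)), addOrderOf_zero, Nat.div_one, if_neg (by decide), one_mul, h3] at h
  have hterm : ∀ s ∈ (Finset.univ : Finset A).erase 0, (if Even (addOrderOf s) then 2 else 1) * 16 ^ (3 / addOrderOf s) = 16 := by
    intro s hs
    rw [hord s (Finset.ne_of_mem_erase hs)]; norm_num
  rw [Finset.sum_congr rfl hterm, Finset.sum_const, Finset.card_erase_of_mem (Finset.mem_univ _), Finset.card_univ, h3] at h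
  norm_num at h
  omega

end One

section Zero

variable {G : Type*} [Group G] [Fintype G] [DecidableEq G] {c : G}
variable {A : Type} [AddCommGroup A] [Fintype A] [DecidableEq A] (D : Datum G c A 0)

omit [Fintype G] [DecidableEq G] [Fintype A] [DecidableEq A] in
/-- `ord ι(x) = ord x`. [folklore] -/
private theorem orderOf_ι (x : ZMod 2 × A) : orderOf (D.ι x) = addOrderOf x := by
  rw [← ιHom_apply, orderOf_injective (ιHom D) (ιHom_injective D), orderOf_ofAdd_eq_addOrderOf]

omit [Fintype G] [DecidableEq G] [Fintype A] [DecidableEq A] in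
/-- **An element outside `ι(H₀)` with `g² = ι x` has order `2 · ord x`**: its order is even (an odd order would put `g` among the powers of `g² ∈ ι(H₀)`),
and `ord (g²) = ord g / 2`. [folklore] -/
private theorem orderOf_eq_two_mul_of_sq {g : G} {x : ZMod 2 × A} (hg : g * g = D.ι x) (hgι : ∀ b, g ≠ D.ι b) : orderOf g = 2 * addOrderOf x := by
  have h2 : orderOf (g ^ 2) = addOrderOf x := by rw [pow_two, hg, orderOf_ι]
  have hev : Even (orderOf g) := by
    rcases Nat.even_or_odd (orderOf g) with h | ⟨k, hk⟩
    · exact h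
    · exfalso
      have h1 : g ^ (2 * k + 1) = 1 := by rw [← hk]; exact pow_orderOf_eq_one g
      rw [pow_succ, pow_mul, pow_two, hg, ← ι_pow] at h1
      exact hgι (-(k • x)) (by rw [ι_neg]; exact eq_inv_of_mul_eq_one_right h1)
  obtain ⟨q, hq⟩ := hev
  have hpow := orderOf_pow' g (n := 2) two_ne_zero
  rw [h2, hq, ← two_mul, Nat.gcd_mul_right_left, Nat.mul_div_cancel_left q two_pos] at hpow
  rw [hq, hpow, two_mul]

omit [DecidableEq G] [DecidableEq A] in
include D in
/-- For `ζ = 0` and `|B|` odd: `y ι(e,s)` has order `2·ord s`, misses `c`, and fixes `4^{|B|/ord s}` labels. [folklore] -/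
private theorem outer_facts_of_zero (hA : Odd (Fintype.card A)) {g : G} (a : ZMod 2 × A) (hg : g * g = D.ι (a + a)) (hgι : ∀ b, g ≠ D.ι b) :
    c ∉ Subgroup.zpowers g ∧ 2 ^ (Fintype.card G / orderOf g / 2) = 4 ^ (Fintype.card A / addOrderOf a.2) := by
  refine ⟨c_notMem_zpowers_of_sq D a hg hgι, ?_⟩
  obtain ⟨e, s⟩ := a
  have hodd : Odd (addOrderOf s) := hA.of_dvd_nat (addOrderOf_dvd_card (x := s))
  have h11 : ∀ u : ZMod 2, u + u = 0 := by decide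
  have hx : addOrderOf (((e, s) : ZMod 2 × A) + (e, s)) = addOrderOf s := by
    rw [Prod.mk_add_mk, h11, addOrderOf_zero_mk, ← two_nsmul, addOrderOf_nsmul' s two_ne_zero, hodd.coprime_two_right.gcd_eq_one, Nat.div_one]
  rw [orderOf_eq_two_mul_of_sq D hg hgι, hx, ← card_group_eq_eight_mul D]
  obtain ⟨d, hd⟩ := addOrderOf_dvd_card (x := s)
  have hpos : 0 < addOrderOf s := addOrderOf_pos s
  have hdiv : Fintype.card A / addOrderOf s = d := by rw [hd, Nat.mul_div_cancel_left d hpos]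
  have hdiv' : 8 * Fintype.card A / (2 * addOrderOf s) / 2 = 2 * d := by
    rw [hd, show 8 * (addOrderOf s * d) = (2 * addOrderOf s) * (4 * d) by ring, Nat.mul_div_cancel_left _ (by omega)]
    omega
  rw [hdiv, hdiv', pow_mul, show (2 : ℕ) ^ 2 = 4 by norm_num]

omit [DecidableEq A] in
include D in
/-- **ζ = 0, `|B|` odd: `β(G, c) · 8|B| = Σ_{s ∈ B} (1 + [ord s even]) · 16^{|B| / ord s} + 4 · Σ_{s ∈ B} 4^{|B| / ord s}`** (the first summand has all
`ord s` odd). [folklore] -/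
theorem card_block_mul_of_zero (hc2 : c * c = 1) (hA : Odd (Fintype.card A)) :
    Fintype.card (BlockParity.Block c) * (8 * Fintype.card A) =
      ∑ s : A, (if Even (addOrderOf s) then 2 else 1) * 16 ^ (Fintype.card A / addOrderOf s) + 4 * ∑ s : A, 4 ^ (Fintype.card A / addOrderOf s) := by
  classical
  have hB : ∀ s : A, ¬ 4 ∣ addOrderOf s := fun s h4 =>
    (Nat.not_even_iff_odd.mpr (hA.of_dvd_nat (addOrderOf_dvd_card (x := s)))) (even_iff_two_dvd.mpr (dvd_trans ⟨2, rfl⟩ h4))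
  rw [card_group_eq_eight_mul D, card_block_mul_card_eq_sum_cosets D hc2, Fintype.sum_prod_type, Fin.sum_univ_four]
  simp only [cosetElt, Matrix.cons_val_zero, Matrix.cons_val_one, Matrix.cons_val]
  rw [sum_ι_coset D]
  have ht : ∀ a : ZMod 2 × A, c ∈ Subgroup.zpowers (D.t * D.ι a) := c_mem_zpowers_tι D hB
  have hy : ∀ a : ZMod 2 × A, c ∉ Subgroup.zpowers (D.y * D.ι a) ∧
      2 ^ (Fintype.card G / orderOf (D.y * D.ι a) / 2) = 4 ^ (Fintype.card A / addOrderOf a.2) := fun a =>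
    outer_facts_of_zero D hA a (by rw [← yι_sq, show ((0 : ZMod 2), (0 : A)) = 0 from rfl, ι_zero, one_mul]) fun b => (ι_ne_yι D b a).symm
  have hty : ∀ a : ZMod 2 × A, c ∉ Subgroup.zpowers (D.t * (D.y * D.ι a)) ∧
      2 ^ (Fintype.card G / orderOf (D.t * (D.y * D.ι a)) / 2) = 4 ^ (Fintype.card A / addOrderOf a.2) := fun a =>
    outer_facts_of_zero D hA a (by rw [← tyι_sq, show ((0 : ZMod 2), (0 : A)) = 0 from rfl, ι_zero, one_mul]) fun b => (ι_ne_tyι D b a).symm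
  simp only [ht, if_true, Finset.sum_const_zero, add_zero, (hy _).1, (hy _).2, (hty _).1, (hty _).2, if_false]
  rw [Fintype.sum_prod_type_right]
  simp only [Finset.sum_const, Finset.card_univ, ZMod.card, smul_eq_mul, ← Finset.mul_sum]
  ring

include D in
/-- `β = 184` for `|B| = 3`, `ζ = 0`: `β · 24 = 16³ + 2·16 + 4·(64 + 4 + 4)`. [folklore] -/
private theorem card_block_eq_oneHundredEightyFour_of_card (hc2 : c * c = 1) (h3 : Fintype.card A = 3) :
    Fintype.card (BlockParity.Block c) = 184 := by
  classical
  have hord : ∀ s : A, s ≠ 0 → addOrderOf s = 3 := fun s hs => by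
    have hd := addOrderOf_dvd_card (x := s); rw [h3] at hd
    rcases (Nat.dvd_prime Nat.prime_three).mp hd with h | h
    · exact absurd (AddMonoid.addOrderOf_eq_one_iff.mp h) hs
    · exact h
  have h := card_block_mul_of_zero D hc2 (by rw [h3]; exact ⟨1, rfl⟩)
  rw [← Finset.add_sum_erase _ _ (Finset.mem_univ (0 : A)), ← Finset.add_sum_erase _ (fun s => 4 ^ (Fintype.card A / addOrderOf s))
    (Finset.mem_univ (0 : A)), addOrderOf_zero, Nat.div_one, if_neg (by decide), one_mul, h3] at h
  have hterm : ∀ s ∈ (Finset.univ : Finset A).erase 0, (if Even (addOrderOf s) then 2 else 1) * 16 ^ (3 / addOrderOf s) = 16 := by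
    intro s hs
    rw [hord s (Finset.ne_of_mem_erase hs)]; norm_num
  have hterm' : ∀ s ∈ (Finset.univ : Finset A).erase 0, 4 ^ (3 / addOrderOf s) = 4 := by
    intro s hs
    rw [hord s (Finset.ne_of_mem_erase hs)]; norm_num
  rw [Finset.sum_congr rfl hterm, Finset.sum_congr rfl hterm', Finset.sum_const, Finset.sum_const, Finset.card_erase_of_mem (Finset.mem_univ _),
    Finset.card_univ, h3] at h
  norm_num at h
  omega

end Zero

section Rows

variable {G : Type*} [Group G] [Fintype G] [DecidableEq G] {c : G}

/-! ## §4 The rows over `ℤ/3` -/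

/-- **`β(Q₈ × ℤ/3) = 172`** (`ζ = 1`; lit-andre-3ʼs `Census/TwentyFourC3Q8*` row; any `(G, c)` carrying an octic product datum of square class `1`
over `ℤ/3`). [folklore] -/
theorem card_block_eq_oneHundredSeventyTwo (D : Datum G c (ZMod 3) 1) (hc2 : c * c = 1) : Fintype.card (BlockParity.Block c) = 172 :=
  card_block_eq_oneHundredSeventyTwo_of_card D hc2 (ZMod.card 3)

/-- **`β(D₄ × ℤ/3) = 184`** with `c = (r², 0)` (`ζ = 0`; any `(G, c)` carrying an octic product datum of square class `0` over `ℤ/3`). [folklore] -/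
theorem card_block_eq_oneHundredEightyFour (D : Datum G c (ZMod 3) 0) (hc2 : c * c = 1) : Fintype.card (BlockParity.Block c) = 184 :=
  card_block_eq_oneHundredEightyFour_of_card D hc2 (ZMod.card 3)

end Rows

end

end Summit.HodgeConjecture.CorCM.Census.OcticProduct
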